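import Summits.BirchSwinnertonDyer.BirchSwinnertonDyer.Theorems.MordellShaFreeCutThreeAdicBDPTripleUpTo

set_option linter.dupNamespace false
set_option autoImplicit false

/-! # Route `MordellShaFreeCut` (rung S2b) — the WHOLE ROUTE in the ♯ currency (BDP triple UP TO
NONZERO CONSTANTS): corank-currency plumbing, crux A (`RankPosOfThreeSelmerCorankOne`, stmt-19159,
residual) ⟺ (res) at `3`, and the leaf `rankOne_threeConverse_mordellCurve` ⟸ {(res) at `3`,
(LB-exist♯)₃, (LB-wan♯)₃, (LB-bdp♯)₃} + Poitou–Tate (imaginary quadratic) + six refereed facts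

Cell `bsd-cn100`, prover seat `bsd-cn100-s2b-c3` (g4); sibling of
`MordellShaFreeCutThreeAdicBDPTripleUpTo.lean` (plan g13 decision (iii) follow-up (2); 400-line rule).
Mordell twin of the S2 census port; ports of p440480 (`MordellShaFreeCutBDPTripleCensus`) and p448851
(`MordellShaFreeCutPoitouTateImQuad`) to the ♯ statements. Supports, does not close,
stmt-BirchSwinnertonDyer-19160 (and serves 19159). HONEST FRAMING: CONDITIONAL reductions only; nothing
here proves crux A, crux B, the leaf, Sylvester's conjecture or any case of BSD. (res) at `3` is the
hypothesis `hres` spelled exactly as the registered `stub_threeLocNonDegeneracy`; Poitou–Tate enters as the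
registered `stub_textbookDualityImQuad` statement (`hPT`). PARTITION: none — RANK axis.

* `heegnerPoint_not_isOfFinAddOrder_of_corankLinkA_of_bdpTripleUpTo` — Link A in CORANK form + the ♯ triple
  ⟹ every Heegner point at a corank-one datum is non-torsion (no Kato, no rank input; same algebra as the
  rank-currency ♯ plumbing: `𝓛(0) ≠ 0` from (LB-wan♯), `𝓛(0) = u·(…)·(log_ω P')²` from (LB-bdp♯));
* `rankPos_minimal_of_corankLinkA_of_bdpTripleUpTo` — globally minimal `j = 0` case of crux A;
* `cruxA_of_res_of_bdpTripleUpTo_of_poitouTate_imaginaryQuadratic`,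
  `cruxA_iff_res_of_bdpTripleUpTo_of_poitouTate_imaginaryQuadratic` — crux A ⟸/⟺ (res) at `3` modulo the
  ♯ triple + PT(imaginary quadratic) + five facts;
* `leaf_of_res_of_bdpTripleUpTo_of_poitouTate_imaginaryQuadratic` — THE ROUTE'S KERNEL CENSUS in the ♯
  currency (+ `…_of_poitouTate`, the `∀ K` binder shape).

[cite: Skinner2020, Thm. B and §2.2–2.3 (shape of (res))] [cite: CastellaGrossiLeeSkinner2022, §5.2 (proof of Thm. 5.2.1), Thm. 5.1.3]
[cite: Castella2018, proof of Thm. 2.3 with Thm. 3.4 (shape)] [cite: MilneADT2006, Ch. I, Thm. 4.10(b)]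
[cite: GrossZagier1986, Thm. I.6.3 with V.§2] -/

noncomputable section

open scoped Classical

namespace Summit.BirchSwinnertonDyer.BirchSwinnertonDyer.Theorems.MordellShaFreeCutBDPTripleUpToCensus

open PowerSeries WeierstrassCurve NumberField IsDedekindDomain Field Literature.NumberTheory.EllipticCurves
  Literature.NumberTheory.EllipticCurves.ModularForms Literature.NumberTheory.QuadraticFields
  Literature.NumberTheory.EllipticCurves.Castella2018
open Literature.NumberTheory.GaloisRepresentations Literature.NumberTheory.GaloisCohomology
open Summit.BirchSwinnertonDyer.BirchSwinnertonDyer.Theses.MordellShaFreeCut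
open Summit.BirchSwinnertonDyer.BirchSwinnertonDyer.Theorems.MordellShaFreeCutThreeAdicBDPTripleUpTo
  (ThreeAdicBDPElementExistsUpTo ThreeAdicWanDivisibilityUpTo ThreeAdicBDPValueAtOneUpTo
    cruxB_of_bdpTripleUpTo_of_poitouTate_imaginaryQuadratic)
open Summit.BirchSwinnertonDyer.BirchSwinnertonDyer.Theorems.MordellShaFreeCutThreeAdicLinksCorank
  (ThreeAdicControlOfCorankOne)
open Summit.BirchSwinnertonDyer.BirchSwinnertonDyer.Theorems.MordellShaFreeCutPoitouTateImQuad
  (threeAdicControlOfCorankOne_of_res_imaginaryQuadratic)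
open Summit.BirchSwinnertonDyer.BirchSwinnertonDyer.Theorems.MordellShaFreeCutLocNonDegeneracy
  (threeLocNonDegeneracy_of_cruxA)

/-! ## 1. Corank-currency plumbing with the ♯ triple -/

/-- **Link A in CORANK form + the ♯ BDP triple force every Heegner point to be non-torsion at a
corank-one datum** (no Kato, no rank hypothesis; port of p440480's
`heegnerPoint_not_isOfFinAddOrder_of_corankLinkA_of_bdpTriple` to (LB-exist♯)/(LB-wan♯)/(LB-bdp♯)): for
`W/ℚ` globally minimal elliptic with `j = 0`, `K` imaginary quadratic with the Heegner hypothesis for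
`N = N(W)` and for `3`, `corank_{ℤ₃} Sel_{3^∞}(W/K) = 1`, and a Heegner point `P` of level `N`:
`F(0) ≠ 0` (`hAc` at THE embedding of a degree-one `v ∣ 3`) ⟹ `𝓛(0) ≠ 0` ((LB-exist♯), (LB-wan♯) along
`X11b.Halves.toUnr 3`) ⟹ `log_ω(τ_* P) ≠ 0` ((LB-bdp♯) at the Galois-conjugate reading) ⟹ `P` not
torsion (`AcPConverseLinks.padicLogPoint_formalIndex_smul_eq_zero_of_isOfFinAddOrder`). CONDITIONAL;
credits nothing. [cite: Castella2018, proof of Thm. 2.3 with Thm. 3.4 (shape)]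
[cite: CastellaGrossiLeeSkinner2022, §5.2 (proof of Thm. 5.2.1)] [cite: SilvermanAEC2009, IV.6.4 and VII.2.2] -/
theorem heegnerPoint_not_isOfFinAddOrder_of_corankLinkA_of_bdpTripleUpTo
    (hAc : ThreeAdicControlOfCorankOne) (hE : ThreeAdicBDPElementExistsUpTo)
    (hWan : ThreeAdicWanDivisibilityUpTo) (hV : ThreeAdicBDPValueAtOneUpTo) :
    ∀ (W : WeierstrassCurve ℚ) [W.IsElliptic] [W.IsGloballyMinimal], W.j = 0 →
      ∀ (K : Type) [Field K] [NumberField K] (N : ℕ) [NeZero N], W.conductorNorm ℤ = N →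
        IsImaginaryQuadratic K → SatisfiesHeegnerHypothesis N K → SatisfiesHeegnerHypothesis 3 K →
          (W.baseChange K).selmerCorank 3 = 1 →
            ∀ (P : (W.baseChange K).toAffine.Point), IsHeegnerPoint N W K P → ¬ IsOfFinAddOrder P := by
  intro W _ _ hj K _ _ N _ hN hK hHN hH3 hcK P hP
  -- (0) `3 = v v̄` splits in `K`
  have hsplit : ((Ideal.span {(3 : ℤ)}).primesOver (𝓞 K)).ncard = 2 := by
    simpa using hH3 3 Nat.prime_three (dvd_refl 3)
  -- (2) the anticyclotomic datum `(κ, γ)`, THE embedding at a degree-one `𝔭 ∋ 3`, `v`, `v̄`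
  obtain ⟨κ, γ, 𝔭, hκ, hγ, h𝔭, he, hf⟩ :=
    Summit.BirchSwinnertonDyer.Rank1Residual.X11b.exists_anticyclotomic_generator_degreeOnePrime
      3 K hK hH3
  haveI : Fact (κ.IsTopGenerator γ) := ⟨hγ⟩
  set ι : K →+* ℚ_[3] := Summit.BirchSwinnertonDyer.Rank1Residual.X11b.embAt K 3 𝔭 h𝔭 he hf
    with hιdef
  set v := Summit.BirchSwinnertonDyer.Rank1Residual.X11b.inducedPlace ι with hvdef
  have hv : ∀ x : 𝓞 K, x ∈ v.asIdeal ↔ ‖ι (x : K)‖ < 1 :=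
    Summit.BirchSwinnertonDyer.Rank1Residual.X11b.mem_inducedPlace_iff ι
  have hv3 : ((3 : ℕ) : 𝓞 K) ∈ v.asIdeal :=
    Summit.BirchSwinnertonDyer.Rank1Residual.X11b.natCast_mem_inducedPlace ι
  obtain ⟨vbar, hvbar, hne⟩ :=
    Summit.BirchSwinnertonDyer.Rank1Residual.X11b.exists_other_prime hH3 v hv3
  -- (3) Link A (corank form) at this datum: a generator `F` of `char_Λ 𝔛` with `F(0) ≠ 0`
  obtain ⟨m, hm⟩ := hAc W hj K N hN hK hHN hH3 ι v vbar hv hvbar hne κ hκ γ hcK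
  obtain ⟨-, F, hF, hF0, -⟩ := hm
  -- (4) the Heegner datum of `P`; the Galois conjugate `P'` read through THE infinite place `w₀`
  obtain ⟨Dt, H, ιK, hPι⟩ := hP
  obtain ⟨w₀⟩ := (inferInstance : Nonempty (InfinitePlace K))
  haveI : IsGalois ℚ K := by
    haveI : Algebra.IsQuadraticExtension ℚ K := ⟨hK.1⟩
    infer_instance
  obtain ⟨σ, hσ⟩ := ComplexEmbedding.exists_comp_symm_eq_of_comp_eq (k := ℚ) w₀.embedding ιK
    (by ext x; simp)
  set τ : K →+* K := ((σ.symm : K ≃ₐ[ℚ] K) : K →+* K) with hτdef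
  set P' := WeierstrassCurve.Affine.Point.map τ.toRatAlgHom P with hP'def
  have hP' : WeierstrassCurve.Affine.Point.map w₀.embedding.toRatAlgHom P' =
      heegnerPointComplex Dt H := by
    rw [hP'def, WeierstrassCurve.Affine.Point.map_map]
    have hcomp : w₀.embedding.toRatAlgHom.comp τ.toRatAlgHom = ιK.toRatAlgHom := by
      apply AlgHom.ext
      intro x
      have := RingHom.congr_fun hσ x
      simpa [hτdef] using this
    rw [hcomp]
    exact hPι
  -- (5) (LB-exist♯): the BDP element up to the constant `C ≠ 0` at `(Dt, v, κ, γ)`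
  obtain ⟨ι', hι', ΩK, Ωp, Cst, L, hΩK, hC, hBDP⟩ := hE W hj K N Dt v κ γ hN hK hHN hsplit hv3 hκ
  -- (6) (LB-wan♯) along the structure map `toUnr : ℤ₃ → R₀` forces `𝓛(0) ≠ 0`
  obtain ⟨k, hk⟩ := hWan W hj ι' K N Dt v vbar κ γ hN hK hHN hsplit hι' hvbar hne hκ ΩK Ωp Cst L hΩK
    hC hBDP (Summit.BirchSwinnertonDyer.Rank1Residual.X11b.Halves.toUnr 3)
    (Summit.BirchSwinnertonDyer.Rank1Residual.X11b.Halves.coe_toUnr 3)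
  have hFmem : F ∈ AcSelmer.XAc.charIdeal (W.baseChange K) 3 κ vbar ∅ γ := by
    rw [hF]; exact Ideal.mem_span_singleton_self F
  obtain ⟨G, hG⟩ := Ideal.mem_span_singleton'.mp (hk F hFmem)
  have hL0 : PowerSeries.constantCoeff L ≠ 0 := by
    intro h0
    have h1 := congrArg (fun S : UnrSeries 3 ↦ ((PowerSeries.constantCoeff S : unrIntegers 3) : ℂ_[3])) hG
    simp only [map_mul, h0, mul_zero, PowerSeries.constantCoeff_C,
      Summit.BirchSwinnertonDyer.Rank1Residual.X11b.CongruenceLimit.constantCoeff_map_apply, Subring.coe_mul,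
      Subring.coe_pow, Subring.coe_zero,
      Summit.BirchSwinnertonDyer.Rank1Residual.X11b.Halves.coe_toUnr] at h1
    have h3' : ((3 : unrIntegers 3) : ℂ_[3]) = (3 : ℂ_[3]) := by norm_cast
    rw [h3'] at h1
    have h3 : algebraMap ℚ_[3] ℂ_[3] ((PowerSeries.constantCoeff F : ℤ_[3]) : ℚ_[3]) = 0 := by
      rcases mul_eq_zero.mp h1.symm with h | h
      · exact absurd (pow_eq_zero_iff'.mp h).1 three_ne_zero
      · exact h
    rw [map_eq_zero_iff _ (algebraMap ℚ_[3] ℂ_[3]).injective] at h3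
    exact hF0 (PadicInt.coe_eq_zero.mp h3)
  -- (7) (LB-bdp♯) at `P'`: `𝓛(0) = u · c⁻² · (…)² · (log_ω P')²`, `u ≠ 0` in `ℂ₃`
  obtain ⟨u, -, hu⟩ := hV W hj ι' K N Dt H w₀ ι v κ γ P' hN hK hHN hsplit hv3 hι' hκ hP' hv ΩK Ωp Cst L
    hΩK hC hBDP
  have hval := UnrSeries.eq_constantCoeff_of_hasValueAt_zero hu
  -- (8) a torsion `P` makes `P'` torsion and `log_ω P' = 0`, contradicting `𝓛(0) ≠ 0`
  intro hPtor
  have hP'tor : IsOfFinAddOrder P' := by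
    rw [hP'def]
    exact AddMonoidHom.isOfFinAddOrder _ hPtor
  have hlog : padicLogOmega W 3 ι P' = 0 := by
    unfold padicLogOmega
    rw [AcPConverseLinks.padicLogPoint_formalIndex_smul_eq_zero_of_isOfFinAddOrder W 3 ι hP'tor,
      zero_div]
  apply hL0
  rw [hlog, zero_pow two_ne_zero, mul_zero, map_zero, mul_zero] at hval
  exact_mod_cast hval.symm


/-! ## 2. Crux A from (res) and the ♯ triple -/

/-- **Globally minimal `j = 0` case of crux A from Link A in corank form and the ♯ triple** (five
refereed facts: `3`-parity, modularity, Hoffstein–Luo, Kato — for the descent field — and Gross 1984):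
descend to the Heegner field (`exists_heegnerField_descent_of_selmerCorank_eq_one`), take a Heegner point,
apply the corank-currency plumbing, Mordell–Weil (port of p440480).
[cite: CastellaGrossiLeeSkinner2022, §5.2 (proof of Thm. 5.2.1)] -/
theorem rankPos_minimal_of_corankLinkA_of_bdpTripleUpTo
    (hpar : ∀ (W : WeierstrassCurve ℚ) [W.IsElliptic] (p : ℕ) [Fact p.Prime], p_parity W p)
    (hmod : ModularForms.exists_isNewformOf) (hHL : HoffsteinLuo1997_exists_twist_L_one_ne_zero)
    (hKato : ∀ (W : WeierstrassCurve ℚ) [W.IsElliptic] (p : ℕ) [Fact p.Prime],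
      kato_finite_of_L_one_ne_zero W p)
    (hHP : ∀ (W : WeierstrassCurve ℚ) (K : Type) [Field K] [NumberField K],
      exists_isHeegnerPoint W K)
    (hAc : ThreeAdicControlOfCorankOne) (hE : ThreeAdicBDPElementExistsUpTo) (hWan : ThreeAdicWanDivisibilityUpTo)
    (hV : ThreeAdicBDPValueAtOneUpTo) :
    ∀ (W : WeierstrassCurve ℚ) [W.IsElliptic] [W.IsGloballyMinimal], W.j = 0 →
      W.selmerCorank 3 = 1 → 1 ≤ W.mordellWeilRank := by
  intro W _ _ hj hc
  haveI : Fact (Nat.Prime 3) := ⟨Nat.prime_three⟩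
  haveI : NeZero (W.conductorNorm ℤ) := ⟨(W.conductorNorm_pos_holds).ne'⟩
  obtain ⟨K, _, _, hK, -, hHN, hH3, -, -, hcK, hrk, -⟩ :=
    exists_heegnerField_descent_of_selmerCorank_eq_one hpar hmod hHL hKato W 3 hc 0
  obtain ⟨P, hP⟩ := hHP W K hK hHN
  have hPnt : ¬ IsOfFinAddOrder P :=
    heegnerPoint_not_isOfFinAddOrder_of_corankLinkA_of_bdpTripleUpTo hAc hE hWan hV W hj K
      (W.conductorNorm ℤ) rfl hK hHN hH3 hcK P hP
  have hrkK : 1 ≤ (W.baseChange K).mordellWeilRank :=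
    one_le_mordellWeilRank_of_not_isOfFinAddOrder _ (W.baseChange K).module_finite_point_holds hPnt
  rwa [hrk] at hrkK

/-- **Crux A `RankPosOfThreeSelmerCorankOne` ⟸ (res) at `3` + the ♯ triple + Poitou–Tate at the imaginary
quadratic fields + five refereed facts** (port of p448851's
`cruxA_of_res_of_bdpTriple_of_poitouTate_imaginaryQuadratic`: Link A in corank form :=
`threeAdicControlOfCorankOne_of_res_imaginaryQuadratic hPT hres`, minimal-model reduction).
CONDITIONAL; credits nothing. [cite: Skinner2020, Thm. B and §2.2–2.3 (shape of (res))]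
[cite: CastellaGrossiLeeSkinner2022, §5.2 (proof of Thm. 5.2.1)] -/
theorem cruxA_of_res_of_bdpTripleUpTo_of_poitouTate_imaginaryQuadratic
    (hpar : ∀ (W : WeierstrassCurve ℚ) [W.IsElliptic] (p : ℕ) [Fact p.Prime], p_parity W p)
    (hmod : ModularForms.exists_isNewformOf) (hHL : HoffsteinLuo1997_exists_twist_L_one_ne_zero)
    (hKato : ∀ (W : WeierstrassCurve ℚ) [W.IsElliptic] (p : ℕ) [Fact p.Prime],
      kato_finite_of_L_one_ne_zero W p)
    (hHP : ∀ (W : WeierstrassCurve ℚ) (K : Type) [Field K] [NumberField K],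
      exists_isHeegnerPoint W K)
    (hPT : ∀ (K : Type) [Field K] [NumberField K], IsImaginaryQuadratic K →
      poitouTate_sum_localTatePairing_eq_zero K)
    (hres : ∀ (W : WeierstrassCurve ℚ) [W.IsElliptic] [W.IsGloballyMinimal], W.j = 0 →
      ∀ (K : Type) [Field K] [NumberField K],
      IsImaginaryQuadratic K → SatisfiesHeegnerHypothesis 3 K →
        (W.baseChange K).selmerCorank 3 = 1 →
      ∀ (w : HeightOneSpectrum (𝓞 K)), ((3 : ℕ) : 𝓞 K) ∈ w.asIdeal →
        Finite ↥((W.baseChange K).selmerGroupPInfty 3 ⊓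
          selmerLocalKerPrimaryTorsion (W.baseChange K) (w.adicCompletion K) 3))
    (hE : ThreeAdicBDPElementExistsUpTo) (hWan : ThreeAdicWanDivisibilityUpTo)
    (hV : ThreeAdicBDPValueAtOneUpTo) :
    RankPosOfThreeSelmerCorankOne := by
  intro D hD hc
  haveI := isElliptic_mordellCurve hD
  haveI : Fact (Nat.Prime 3) := ⟨Nat.prime_three⟩
  obtain ⟨C, hmin⟩ := hasGlobalMinimalModel_rat_holds (mordellCurve D)
  haveI : (C • mordellCurve D).IsGloballyMinimal := hmin
  have hj : (C • mordellCurve D).j = 0 := by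
    rw [variableChange_j]; exact (mordellCurve D).j_eq_zero (mordellCurve_c₄ _)
  have hc' : (C • mordellCurve D).selmerCorank 3 = 1 := by
    rw [← selmerCorank_eq_of_variableChange 3 (rfl : C • mordellCurve D = C • mordellCurve D)]
    exact hc
  have h1 := rankPos_minimal_of_corankLinkA_of_bdpTripleUpTo hpar hmod hHL hKato hHP
    (threeAdicControlOfCorankOne_of_res_imaginaryQuadratic hPT hres) hE hWan hV (C • mordellCurve D) hj hc'
  rwa [mordellWeilRank_variableChange_holds] at h1

/-- **Kernel census of the residual in the ♯ currency: modulo the ♯ triple, Poitou–Tate at the imaginary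
quadratic fields and five refereed facts, crux A ⟺ (res) at `3`** (`⟹`: the fact-free
`MordellShaFreeCutLocNonDegeneracy.threeLocNonDegeneracy_of_cruxA`, p435058). CONDITIONAL; credits nothing.
[cite: Skinner2020, Thm. B and §2.2 (shape of (res))] [cite: WZhang2014, Thm. 1.3 and Remark 2 (p. 198)] -/
theorem cruxA_iff_res_of_bdpTripleUpTo_of_poitouTate_imaginaryQuadratic
    (hpar : ∀ (W : WeierstrassCurve ℚ) [W.IsElliptic] (p : ℕ) [Fact p.Prime], p_parity W p)
    (hmod : ModularForms.exists_isNewformOf) (hHL : HoffsteinLuo1997_exists_twist_L_one_ne_zero)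
    (hKato : ∀ (W : WeierstrassCurve ℚ) [W.IsElliptic] (p : ℕ) [Fact p.Prime],
      kato_finite_of_L_one_ne_zero W p)
    (hHP : ∀ (W : WeierstrassCurve ℚ) (K : Type) [Field K] [NumberField K],
      exists_isHeegnerPoint W K)
    (hPT : ∀ (K : Type) [Field K] [NumberField K], IsImaginaryQuadratic K →
      poitouTate_sum_localTatePairing_eq_zero K)
    (hE : ThreeAdicBDPElementExistsUpTo) (hWan : ThreeAdicWanDivisibilityUpTo)
    (hV : ThreeAdicBDPValueAtOneUpTo) :
    RankPosOfThreeSelmerCorankOne ↔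
      ∀ (W : WeierstrassCurve ℚ) [W.IsElliptic] [W.IsGloballyMinimal], W.j = 0 →
        ∀ (K : Type) [Field K] [NumberField K],
        IsImaginaryQuadratic K → SatisfiesHeegnerHypothesis 3 K →
          (W.baseChange K).selmerCorank 3 = 1 →
        ∀ (w : HeightOneSpectrum (𝓞 K)), ((3 : ℕ) : 𝓞 K) ∈ w.asIdeal →
          Finite ↥((W.baseChange K).selmerGroupPInfty 3 ⊓
            selmerLocalKerPrimaryTorsion (W.baseChange K) (w.adicCompletion K) 3) :=
  ⟨fun hA W _ _ hj K _ _ hK hH3 hcK w hw ↦ threeLocNonDegeneracy_of_cruxA hA W hj K hK hH3 hcK w hw,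
    fun hres ↦ cruxA_of_res_of_bdpTripleUpTo_of_poitouTate_imaginaryQuadratic hpar hmod hHL hKato hHP hPT
      hres hE hWan hV⟩

/-! ## 3. The whole route in the ♯ currency -/

/-- **THE ROUTE'S KERNEL CENSUS in the ♯ currency: the rung-S2b leaf `rankOne_threeConverse_mordellCurve`
⟸ {(res) at `3`, (LB-exist♯)₃, (LB-wan♯)₃, (LB-bdp♯)₃} + Poitou–Tate(imaginary quadratic) + six refereed
facts** (`3`-parity, modularity, Hoffstein–Luo, Kato, Gross 1984, Gross–Zagier + Kolyvagin): the route's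
Assembly (`MordellShaFreeCutAssembly.assembly_holds`) of crux A
(`cruxA_of_res_of_bdpTripleUpTo_of_poitouTate_imaginaryQuadratic`) and crux B
(`MordellShaFreeCutThreeAdicBDPTripleUpTo.cruxB_of_bdpTripleUpTo_of_poitouTate_imaginaryQuadratic`).
CONDITIONAL; neither BSD nor Sylvester's conjecture is touched. [cite: GrossZagier1986, Thm. I.6.3 with V.§2]
[cite: CastellaGrossiLeeSkinner2022, §5.2 (proof of Thm. 5.2.1)] [cite: MilneADT2006, Ch. I, Thm. 4.10(b)] -/
theorem leaf_of_res_of_bdpTripleUpTo_of_poitouTate_imaginaryQuadratic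
    (hpar : ∀ (W : WeierstrassCurve ℚ) [W.IsElliptic] (p : ℕ) [Fact p.Prime], p_parity W p)
    (hmod : ModularForms.exists_isNewformOf) (hHL : HoffsteinLuo1997_exists_twist_L_one_ne_zero)
    (hKato : ∀ (W : WeierstrassCurve ℚ) [W.IsElliptic] (p : ℕ) [Fact p.Prime],
      kato_finite_of_L_one_ne_zero W p)
    (hHP : ∀ (W : WeierstrassCurve ℚ) (K : Type) [Field K] [NumberField K],
      exists_isHeegnerPoint W K)
    (hGZ : ∀ (W : WeierstrassCurve ℚ) (N : ℕ) [NeZero N] (K : Type) [Field K] [NumberField K],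
      analyticRankEK_eq_one_iff_heegner_nonTorsion W N K)
    (hPT : ∀ (K : Type) [Field K] [NumberField K], IsImaginaryQuadratic K →
      poitouTate_sum_localTatePairing_eq_zero K)
    (hres : ∀ (W : WeierstrassCurve ℚ) [W.IsElliptic] [W.IsGloballyMinimal], W.j = 0 →
      ∀ (K : Type) [Field K] [NumberField K],
      IsImaginaryQuadratic K → SatisfiesHeegnerHypothesis 3 K →
        (W.baseChange K).selmerCorank 3 = 1 →
      ∀ (w : HeightOneSpectrum (𝓞 K)), ((3 : ℕ) : 𝓞 K) ∈ w.asIdeal →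
        Finite ↥((W.baseChange K).selmerGroupPInfty 3 ⊓
          selmerLocalKerPrimaryTorsion (W.baseChange K) (w.adicCompletion K) 3))
    (hE : ThreeAdicBDPElementExistsUpTo) (hWan : ThreeAdicWanDivisibilityUpTo)
    (hV : ThreeAdicBDPValueAtOneUpTo) :
    rankOne_threeConverse_mordellCurve :=
  MordellShaFreeCutAssembly.assembly_holds
    (cruxA_of_res_of_bdpTripleUpTo_of_poitouTate_imaginaryQuadratic hpar hmod hHL hKato hHP hPT hres
      hE hWan hV)
    (cruxB_of_bdpTripleUpTo_of_poitouTate_imaginaryQuadratic hpar hmod hHL hKato hHP hGZ hPT hE hWan hV)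

/-- The same with Poitou–Tate at every number field (the `∀ K` binder shape), by specialisation.
CONDITIONAL; credits nothing. [cite: MilneADT2006, Ch. I, Thm. 4.10(b)] [cite: GrossZagier1986, Thm. I.6.3 with V.§2] -/
theorem leaf_of_res_of_bdpTripleUpTo_of_poitouTate
    (hpar : ∀ (W : WeierstrassCurve ℚ) [W.IsElliptic] (p : ℕ) [Fact p.Prime], p_parity W p)
    (hmod : ModularForms.exists_isNewformOf) (hHL : HoffsteinLuo1997_exists_twist_L_one_ne_zero)
    (hKato : ∀ (W : WeierstrassCurve ℚ) [W.IsElliptic] (p : ℕ) [Fact p.Prime],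
      kato_finite_of_L_one_ne_zero W p)
    (hHP : ∀ (W : WeierstrassCurve ℚ) (K : Type) [Field K] [NumberField K],
      exists_isHeegnerPoint W K)
    (hGZ : ∀ (W : WeierstrassCurve ℚ) (N : ℕ) [NeZero N] (K : Type) [Field K] [NumberField K],
      analyticRankEK_eq_one_iff_heegner_nonTorsion W N K)
    (hPT : ∀ (K : Type) [Field K] [NumberField K], poitouTate_sum_localTatePairing_eq_zero K)
    (hres : ∀ (W : WeierstrassCurve ℚ) [W.IsElliptic] [W.IsGloballyMinimal], W.j = 0 →
      ∀ (K : Type) [Field K] [NumberField K],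
      IsImaginaryQuadratic K → SatisfiesHeegnerHypothesis 3 K →
        (W.baseChange K).selmerCorank 3 = 1 →
      ∀ (w : HeightOneSpectrum (𝓞 K)), ((3 : ℕ) : 𝓞 K) ∈ w.asIdeal →
        Finite ↥((W.baseChange K).selmerGroupPInfty 3 ⊓
          selmerLocalKerPrimaryTorsion (W.baseChange K) (w.adicCompletion K) 3))
    (hE : ThreeAdicBDPElementExistsUpTo) (hWan : ThreeAdicWanDivisibilityUpTo)
    (hV : ThreeAdicBDPValueAtOneUpTo) :
    rankOne_threeConverse_mordellCurve :=
  leaf_of_res_of_bdpTripleUpTo_of_poitouTate_imaginaryQuadratic hpar hmod hHL hKato hHP hGZ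
    (fun K _ _ _ ↦ hPT K) hres hE hWan hV

end Summit.BirchSwinnertonDyer.BirchSwinnertonDyer.Theorems.MordellShaFreeCutBDPTripleUpToCensus

end
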